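import Mathlib

/-!
# `HyperbolicEnd` (stmt-SmoothPoincare4-7825), line `Sketch`, negative side — Ahlfors line test against the Poincaré weight of a disc

Helper for the negative side of the line `Sketch` (`Theorems/HyperbolicEnd/Negative/`, frozen-`J`
certificate filling fails in complex dimension one); statement registered on the crux item
(stub helper_discLineTest), used by the growth bound along complex lines (`helper_lineGrowth`).

**The line test.** Let `λ` be `C²` near `w` with `λ(w) > 0` and
`2c' λ³ ≤ λ Δλ - |∇λ|²` at `w` (Gauss curvature of `λ|dz|²` at most `-c'`), and suppose that
`Q(z) = λ(z) (ρ² - ‖z‖²)²` has a local maximum at a point `w` of the open disc `‖w‖ < ρ`.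
Restricting `Q` to the two real lines `t ↦ w + t` and `t ↦ w + tI` — along which the weight is
the polynomial `(h - 2Bt - t²)²` with `h = ρ² - ‖w‖² > 0` and `B = re w` resp. `B = im w` — and
writing out the first- and second-order conditions at `t = 0` (`line_test`), then combining them
with the curvature inequality and `Δλ = ∂ₓₓλ + ∂_yyλ` by elementary algebra (`algebra_step`),
one gets `c' · Q(w) ≤ 4ρ²`: the comparison of `λ` with the Poincaré density
`4ρ² / (c' (ρ² - ‖z‖²)²)` of curvature `-c'` on the disc of radius `ρ` (the Ahlfors–Schwarz lemma
in maximum-principle form).  The one-variable calculus along real lines is copied from the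
sibling `NeckLineTest.lean` (same folder).
-/

noncomputable section

-- the prescribed namespace `Summit.<P>.<Sub>.…` duplicates `SmoothPoincare4` (P = Sub)
set_option linter.dupNamespace false

open scoped ContDiff Topology Real
open Laplacian Set Filter Metric Complex

namespace Summit.SmoothPoincare4.SmoothPoincare4.Theorems.HyperbolicEnd.Negative

/-! ### One-variable calculus along real lines in `ℂ` (local versions) -/

/-- Derivative of `f : ℂ → F` along the real line `t ↦ z + t • v` at a parameter `t` where `f` is
differentiable (copied from `NeckLineTest.lean`). -/
private theorem hasDerivAt_line {F : Type*} [NormedAddCommGroup F] [NormedSpace ℝ F]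
    {f : ℂ → F} (z v : ℂ) (t : ℝ) (hf : DifferentiableAt ℝ f (z + t • v)) :
    HasDerivAt (fun s : ℝ => f (z + s • v)) (fderiv ℝ f (z + t • v) v) t := by
  have hl : HasDerivAt (fun s : ℝ => z + s • v) v t := by
    simpa using ((hasDerivAt_id t).smul_const v).const_add z
  exact hf.hasFDerivAt.comp_hasDerivAt t hl

/-- Second derivative along the line: for `f` of class `C²` at `z`, `t ↦ Df(z + t v) v` has
derivative `D²f(z)(v, v)` at `t = 0` (copied from `NeckLineTest.lean`). -/
private theorem hasDerivAt_line_fderiv {f : ℂ → ℝ} {z : ℂ} (hf : ContDiffAt ℝ 2 f z) (v : ℂ) :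
    HasDerivAt (fun s : ℝ => fderiv ℝ f (z + s • v) v) (fderiv ℝ (fderiv ℝ f) z v v) 0 := by
  have hD : DifferentiableAt ℝ (fderiv ℝ f) z :=
    (hf.fderiv_right (m := 1) (by norm_num)).differentiableAt one_ne_zero
  have hl : HasDerivAt (fun s : ℝ => z + s • v) v 0 := by
    simpa using ((hasDerivAt_id (0 : ℝ)).smul_const v).const_add z
  have hD' : HasFDerivAt (fderiv ℝ f) (fderiv ℝ (fderiv ℝ f) z) (z + (0 : ℝ) • v) := by
    rw [zero_smul, add_zero]
    exact hD.hasFDerivAt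
  have h1 : HasDerivAt (fun s : ℝ => fderiv ℝ f (z + s • v)) (fderiv ℝ (fderiv ℝ f) z v) 0 :=
    hD'.comp_hasDerivAt (0 : ℝ) hl
  have h2 := h1.clm_apply (hasDerivAt_const (0 : ℝ) v)
  simpa using h2

/-- A function of class `C²` at `z` is differentiable at the points `z + t v` for `t` near `0`
(copied from `NeckLineTest.lean`). -/
private theorem eventually_differentiableAt_line {f : ℂ → ℝ} {z : ℂ} (hf : ContDiffAt ℝ 2 f z)
    (v : ℂ) : ∀ᶠ t in 𝓝 (0 : ℝ), DifferentiableAt ℝ f (z + t • v) := by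
  have hev : ∀ᶠ y in 𝓝 z, ContDiffAt ℝ 2 f y := hf.eventually (by simp)
  have hl : Continuous fun s : ℝ => z + s • v := by fun_prop
  have ht : Tendsto (fun s : ℝ => z + s • v) (𝓝 0) (𝓝 z) := by
    simpa using hl.tendsto 0
  exact (ht.eventually hev).mono fun t ht => ht.differentiableAt two_ne_zero

/-- One-dimensional second-derivative test, necessary form: at a local maximum where `φ` is
continuous, `φ'' ≤ 0` (otherwise the sufficient second-derivative test makes the point also a
local minimum, `φ` is locally constant and `φ'' = 0` there).  Copied from `NeckLineTest.lean`. -/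
private theorem deriv_deriv_nonpos_of_isLocalMax {φ : ℝ → ℝ} {t₀ : ℝ} (h : IsLocalMax φ t₀)
    (hc : ContinuousAt φ t₀) : deriv (deriv φ) t₀ ≤ 0 := by
  by_contra hpos
  have hpos' : 0 < deriv (deriv φ) t₀ := lt_of_not_ge hpos
  have hmin : IsLocalMin φ t₀ := isLocalMin_of_deriv_deriv_pos hpos' h.deriv_eq_zero hc
  have heq : φ =ᶠ[𝓝 t₀] fun _ => φ t₀ :=
    (h.and hmin).mono fun s hs => le_antisymm hs.1 hs.2
  have h2 : deriv (deriv φ) t₀ = deriv (deriv fun _ : ℝ => φ t₀) t₀ := heq.deriv.deriv_eq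
  rw [h2] at hpos'
  simp at hpos'

/-- First- and second-order conditions at a local maximum, for a function with a derivative `ψ'`
near the point which is itself differentiable at the point: `ψ'(t₀) = 0` and `ψ''(t₀) ≤ 0`
(copied from `NeckLineTest.lean`). -/
private theorem deriv_test {ψ ψ' : ℝ → ℝ} {d t₀ : ℝ} (hψ : ∀ᶠ t in 𝓝 t₀, HasDerivAt ψ (ψ' t) t)
    (hψ' : HasDerivAt ψ' d t₀) (hmax : IsLocalMax ψ t₀) : ψ' t₀ = 0 ∧ d ≤ 0 := by
  have h0 : HasDerivAt ψ (ψ' t₀) t₀ := hψ.self_of_nhds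
  have h1 : deriv ψ =ᶠ[𝓝 t₀] ψ' := hψ.mono fun t ht => ht.deriv
  refine ⟨hmax.hasDerivAt_eq_zero h0, ?_⟩
  have h2 : deriv (deriv ψ) t₀ = d := by
    rw [h1.deriv_eq]
    exact hψ'.deriv
  rw [← h2]
  exact deriv_deriv_nonpos_of_isLocalMax hmax h0.continuousAt

/-! ### The disc weight along a line -/

/-- The squared norm along the real line `s ↦ z + s • v` is the quadratic polynomial
`‖z‖² + 2Bs + ‖v‖² s²` with `B = re z · re v + im z · im v`. -/
private theorem norm_sq_line (z v : ℂ) (s : ℝ) :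
    ‖z + s • v‖ ^ 2 = ‖z‖ ^ 2 + 2 * (z.re * v.re + z.im * v.im) * s + ‖v‖ ^ 2 * s ^ 2 := by
  simp only [Complex.sq_norm, Complex.normSq_apply, Complex.add_re, Complex.add_im,
    Complex.smul_re, Complex.smul_im, smul_eq_mul]
  ring

/-- Derivative of the quadratic polynomial `s ↦ h - 2Bs - Ns²`. -/
private theorem hasDerivAt_quad (h B N t : ℝ) :
    HasDerivAt (fun s : ℝ => h - 2 * B * s - N * s ^ 2) (-2 * B - 2 * N * t) t := by
  have h1 : HasDerivAt (fun s : ℝ => 2 * B * s) (2 * B) t :=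
    ((hasDerivAt_id' t).const_mul (2 * B)).congr_deriv (mul_one _)
  have h2 : HasDerivAt (fun s : ℝ => N * s ^ 2) (N * (2 * t)) t :=
    ((hasDerivAt_pow 2 t).const_mul N).congr_deriv (by norm_num)
  exact ((h1.const_sub h).fun_sub h2).congr_deriv (by ring)

/-- Derivative of the weight `s ↦ (h - 2Bs - Ns²)²` along a line. -/
private theorem hasDerivAt_weight (h B N t : ℝ) :
    HasDerivAt (fun s : ℝ => (h - 2 * B * s - N * s ^ 2) ^ 2)
      (2 * (h - 2 * B * t - N * t ^ 2) * (-2 * B - 2 * N * t)) t := by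
  refine ((hasDerivAt_quad h B N t).fun_pow 2).congr_deriv ?_
  push_cast
  ring

/-- Derivative of `s ↦ 2(h - 2Bs - Ns²)(-2B - 2Ns)`, the derivative of the weight. -/
private theorem hasDerivAt_weight' (h B N t : ℝ) :
    HasDerivAt (fun s : ℝ => 2 * (h - 2 * B * s - N * s ^ 2) * (-2 * B - 2 * N * s))
      (2 * (-2 * B - 2 * N * t) * (-2 * B - 2 * N * t) +
        2 * (h - 2 * B * t - N * t ^ 2) * (-2 * N)) t := by
  have h3 : HasDerivAt (fun s : ℝ => 2 * N * s) (2 * N) t :=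
    ((hasDerivAt_id' t).const_mul (2 * N)).congr_deriv (mul_one _)
  refine (((hasDerivAt_quad h B N t).const_mul 2).fun_mul (h3.const_sub (-2 * B))).congr_deriv ?_
  ring

/-! ### The line test at a local maximum of `f · W` -/

/-- **Line test.** Let `w ↦ f(w) W(w)` have a local maximum at `z` (`f` of class `C²` at `z`),
and suppose that along the real line `s ↦ z + s v` the weight is the polynomial
`W(z + s v) = (h - 2Bs - Ns²)²`.  Then the first derivative of the restriction of `f W` to the
line vanishes at `s = 0` and the second one is `≤ 0`; written out, using that the weight along
the line has the value `h²`, first derivative `-4Bh` and second derivative `8B² - 4Nh` at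
`s = 0`. -/
private theorem line_test {f W : ℂ → ℝ} {z : ℂ} (hf : ContDiffAt ℝ 2 f z)
    (hmax : IsLocalMax (fun w => f w * W w) z) (v : ℂ) {h B N : ℝ}
    (hW : ∀ s : ℝ, W (z + s • v) = (h - 2 * B * s - N * s ^ 2) ^ 2) :
    fderiv ℝ f z v * h ^ 2 + f z * (-4 * B * h) = 0 ∧
      fderiv ℝ (fderiv ℝ f) z v v * h ^ 2 + 2 * (fderiv ℝ f z v * (-4 * B * h)) +
        f z * (8 * B ^ 2 - 4 * N * h) ≤ 0 := by
  -- the restriction to the line has a local maximum at `0`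
  have hmax0 : IsLocalMax (fun s : ℝ => f (z + s • v) * W (z + s • v)) 0 := by
    have hz : IsLocalMax (fun w => f w * W w) ((fun s : ℝ => z + s • v) 0) := by
      simpa using hmax
    exact hz.comp_continuous (g := fun s : ℝ => z + s • v) (by fun_prop)
  -- along the line the weight is the polynomial `(h - 2Bs - Ns²)²`
  have hfun : (fun s : ℝ => f (z + s • v) * W (z + s • v)) =
      fun s => f (z + s • v) * (h - 2 * B * s - N * s ^ 2) ^ 2 := by
    funext s
    rw [hW]
  rw [hfun] at hmax0
  -- derivatives along the line
  have hf1 : ∀ᶠ t in 𝓝 (0 : ℝ),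
      HasDerivAt (fun s : ℝ => f (z + s • v)) (fderiv ℝ f (z + t • v) v) t :=
    (eventually_differentiableAt_line hf v).mono fun t ht => hasDerivAt_line z v t ht
  have hf10 : HasDerivAt (fun s : ℝ => f (z + s • v)) (fderiv ℝ f (z + (0 : ℝ) • v) v) 0 :=
    hf1.self_of_nhds
  have hf2 := hasDerivAt_line_fderiv hf v
  have hψ : ∀ᶠ t in 𝓝 (0 : ℝ),
      HasDerivAt (fun s : ℝ => f (z + s • v) * (h - 2 * B * s - N * s ^ 2) ^ 2)
        (fderiv ℝ f (z + t • v) v * (h - 2 * B * t - N * t ^ 2) ^ 2 +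
          f (z + t • v) * (2 * (h - 2 * B * t - N * t ^ 2) * (-2 * B - 2 * N * t))) t :=
    hf1.mono fun t ht => ht.fun_mul (hasDerivAt_weight h B N t)
  have hψ' := (hf2.fun_mul (hasDerivAt_weight h B N 0)).fun_add
    (hf10.fun_mul (hasDerivAt_weight' h B N 0))
  obtain ⟨h1, h2⟩ := deriv_test hψ hψ' hmax0
  simp only [zero_smul, add_zero] at h1 h2
  constructor
  · linear_combination h1
  · linarith [h2]

/-! ### The pointwise algebra -/

/-- **The pointwise algebra** of the comparison with the Poincaré weight at a positive interior
maximum: with `L = λ(w) > 0`, `h = ρ² - ‖w‖² > 0`, `‖w‖² = x² + y²`, the two first-order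
relations (`p h = 4xL`, `q h = 4yL`), the two second-order inequalities and the curvature
hypothesis give `c L h² ≤ 4ρ²` (multiply the curvature inequality by `h²`, the second-order ones
by `L`, and use `x² + y² + h = ρ²`). -/
private theorem algebra_step {c L h x y ρ p q s u : ℝ} (hL : 0 < L) (hh : 0 < h)
    (hρ : h + (x ^ 2 + y ^ 2) = ρ ^ 2)
    (ha1 : p * h ^ 2 + L * (-4 * x * h) = 0) (ha2 : q * h ^ 2 + L * (-4 * y * h) = 0)
    (hb1 : s * h ^ 2 + 2 * (p * (-4 * x * h)) + L * (8 * x ^ 2 - 4 * 1 * h) ≤ 0)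
    (hb2 : u * h ^ 2 + 2 * (q * (-4 * y * h)) + L * (8 * y ^ 2 - 4 * 1 * h) ≤ 0)
    (hd : 2 * c * L ^ 3 ≤ L * (s + u) - (p ^ 2 + q ^ 2)) :
    c * (L * h ^ 2) ≤ 4 * ρ ^ 2 := by
  -- first-order relations: `p h = 4xL`, `q h = 4yL`
  have hph : p * h = 4 * x * L := by
    have e : h * (p * h - 4 * x * L) = 0 := by linear_combination ha1
    have := (mul_eq_zero.1 e).resolve_left hh.ne'
    linarith
  have hqh : q * h = 4 * y * L := by
    have e : h * (q * h - 4 * y * L) = 0 := by linear_combination ha2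
    have := (mul_eq_zero.1 e).resolve_left hh.ne'
    linarith
  -- multiply the curvature inequality by `h² ≥ 0` and the second-order ones by `L ≥ 0`
  have i1 : 2 * c * L ^ 3 * h ^ 2 ≤ (L * (s + u) - (p ^ 2 + q ^ 2)) * h ^ 2 :=
    mul_le_mul_of_nonneg_right hd (by positivity)
  have i2 := mul_nonpos_of_nonneg_of_nonpos hL.le hb1
  have i3 := mul_nonpos_of_nonneg_of_nonpos hL.le hb2
  have e1 : p ^ 2 * h ^ 2 = 16 * x ^ 2 * L ^ 2 := by
    linear_combination (p * h + 4 * x * L) * hph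
  have e2 : q ^ 2 * h ^ 2 = 16 * y ^ 2 * L ^ 2 := by
    linear_combination (q * h + 4 * y * L) * hqh
  have e3 : L * (2 * (p * (-4 * x * h))) = -32 * x ^ 2 * L ^ 2 := by
    linear_combination (-8 * x * L) * hph
  have e4 : L * (2 * (q * (-4 * y * h))) = -32 * y ^ 2 * L ^ 2 := by
    linear_combination (-8 * y * L) * hqh
  have e5 : 8 * L ^ 2 * h + 8 * L ^ 2 * (x ^ 2 + y ^ 2) = 8 * L ^ 2 * ρ ^ 2 := by
    linear_combination (8 * L ^ 2) * hρ
  have key : 2 * c * L ^ 3 * h ^ 2 ≤ 8 * L ^ 2 * ρ ^ 2 := by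
    linarith [i1, i2, i3, e1, e2, e3, e4, e5]
  have h2L : 0 < 2 * L ^ 2 := by positivity
  have key' : 2 * L ^ 2 * (c * (L * h ^ 2)) ≤ 2 * L ^ 2 * (4 * ρ ^ 2) := by nlinarith [key]
  exact le_of_mul_le_mul_left key' h2L

/-! ### The helper -/

/-- helper: Ahlfors–Schwarz line test against the Poincaré weight `(ρ² - ‖z‖²)²` of the disc of
radius `ρ`.  At a local maximum `w` with `‖w‖ < ρ` of `Q = λ · (ρ² - ‖z‖²)²`, for `λ` of class
`C²` at `w` with `λ(w) > 0` satisfying the curvature inequality `2c'λ³ ≤ λΔλ - |∇λ|²` at `w`,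
one has `c' Q(w) ≤ 4ρ²`. -/
theorem helper_discLineTest : ∀ (lam : ℂ → ℝ) (w : ℂ) (ρ c' : ℝ), ContDiffAt ℝ 2 lam w →
    0 < lam w → ‖w‖ < ρ → 2 * c' * lam w ^ 3 ≤
      lam w * (Δ lam) w - ((fderiv ℝ lam w 1) ^ 2 + (fderiv ℝ lam w Complex.I) ^ 2) →
    IsLocalMax (fun z => lam z * (ρ ^ 2 - ‖z‖ ^ 2) ^ 2) w →
    c' * (lam w * (ρ ^ 2 - ‖w‖ ^ 2) ^ 2) ≤ 4 * ρ ^ 2 := by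
  intro lam w ρ c' hlam hpos hw hineq hmax
  -- the weight along the two lines `s ↦ w + s` and `s ↦ w + sI`
  have h1sq : ∀ s : ℝ, (ρ ^ 2 - ‖w + s • (1 : ℂ)‖ ^ 2) ^ 2 =
      (ρ ^ 2 - ‖w‖ ^ 2 - 2 * w.re * s - 1 * s ^ 2) ^ 2 := by
    intro s
    rw [norm_sq_line]
    simp only [Complex.one_re, Complex.one_im, norm_one]
    ring
  have hIsq : ∀ s : ℝ, (ρ ^ 2 - ‖w + s • Complex.I‖ ^ 2) ^ 2 =
      (ρ ^ 2 - ‖w‖ ^ 2 - 2 * w.im * s - 1 * s ^ 2) ^ 2 := by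
    intro s
    rw [norm_sq_line]
    simp only [Complex.I_re, Complex.I_im, Complex.norm_I]
    ring
  obtain ⟨ha1, hb1⟩ := line_test (f := lam) (W := fun z => (ρ ^ 2 - ‖z‖ ^ 2) ^ 2)
    (h := ρ ^ 2 - ‖w‖ ^ 2) (B := w.re) (N := 1) hlam hmax 1 h1sq
  obtain ⟨ha2, hb2⟩ := line_test (f := lam) (W := fun z => (ρ ^ 2 - ‖z‖ ^ 2) ^ 2)
    (h := ρ ^ 2 - ‖w‖ ^ 2) (B := w.im) (N := 1) hlam hmax Complex.I hIsq
  -- `Δλ = ∂ₓₓλ + ∂_yyλ`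
  have hΔ : (Δ lam) w = fderiv ℝ (fderiv ℝ lam) w 1 1 +
      fderiv ℝ (fderiv ℝ lam) w Complex.I Complex.I := by
    rw [InnerProductSpace.laplacian_eq_iteratedFDeriv_complexPlane lam]
    simp [iteratedFDeriv_two_apply]
  rw [hΔ] at hineq
  -- `‖w‖² = x² + y²` and `h = ρ² - ‖w‖² > 0`
  have hnorm : ‖w‖ ^ 2 = w.re ^ 2 + w.im ^ 2 := by
    rw [Complex.sq_norm, Complex.normSq_apply]
    ring
  have hh : 0 < ρ ^ 2 - ‖w‖ ^ 2 := by nlinarith [norm_nonneg w, hw]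
  exact algebra_step (c := c') hpos hh (by linear_combination (-1 : ℝ) * hnorm)
    ha1 ha2 hb1 hb2 hineq

end Summit.SmoothPoincare4.SmoothPoincare4.Theorems.HyperbolicEnd.Negative

end
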